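import Summits.QuantumFields.YangMills.Theorems.BalabanLadderIRcofEquipartitionSeamUnitDefs
import Summits.QuantumFields.YangMills.Theorems.BalabanLadderIRRankPurityCofinalDefs
import Literature.MathematicalPhysics.QuantumFieldTheory.WilsonFinTorusTwistTensor
import HarnessLib

/-!
# Crux `IRcof` (stmt-QuantumFields-26930), line `equipartition_seam` (row 47): KERNEL-CURRENCY DEFINITIONS for skeleton rev 8 (β)
# (definitions only; LEAD prover ym-ir-line-ab-p1 gen 8, LAND-ASK of ideator ym-ir-idea-22 g6, crit-3 g5 TYPEREAD CLEAN + GO 2026-08-29T01:47Z)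

SOURCE OF RECORD: `Cruxes/IRcof/Lines/equipartition_seam_KernelCurrency.lean` rev 3 (crux write 5128c8e98283; author ideator ym-ir-idea-22 g6,
typing riders R1 ∕ `0 ≤ nrm A` ∕ (N-b) by prover ym-ir-line-pool-p3 g16; critic ym-ir-crit-3 g5 STAMP conditions C-i…C-iv, bus l.1592 ∕ 1599 ∕ 1618 ∕ 1625):
its §A (canonical objects), §B (per-`β` predicates) and §C (the four rev-8 (β) stub texts S3ʷ ∕ T ∕ D ∕ N) VERBATIM in namespace
`…Cruxes.IRcof.EquipartitionSeam.KernelCurrency`, and its §C′ — the skeleton-rev-7 texts `SplitVanishing` (l.171 there), `EquiUnits` (S3, l.183),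
`EBlindUnitsV` (S4ᵛ, l.198) — VERBATIM in the PARENT namespace `…Cruxes.IRcof.EquipartitionSeam` (the skeleton `Cruxes/IRcof/Lines/equipartition_seam.lean`
has no farm olean, so nothing can import those texts from it; rev 8 deletes its copies and cites these BY NAME).  §D of the source (bridges
B1 `equiUnits_of_window`, B2 `eblindUnitsV_of_peeling`) is NOT here: it lands as pool-p3's helper `…Theorems.BalabanLadderIRcofEquipartitionSeamKernelBridges`
importing this file.  No theorem, no `sorry`, no instance, no notation.

WHAT THE DEFINITIONS SAY (ideator's text, abridged; full rationale in the source docstrings below, kept verbatim):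
* §A canonical objects of the split-weight (`w`-) cover theory in SUMMIT conventions (time = axis 0, sectors = `Sector π`): `sectorTensor`,
  `withEl` ∕ `elOff` (electric part of a sector), `secZ` (sector partition function on the box `s × (2S+1)³`), `secW` (species-inserted,
  symmetric box), `growthRate` (`limsup Z^{1/m}`, the C-iii-a identification `λ₊ = growthRate`).
* §B per-`β` predicates `EquiWindowOn` (S3ʷ at one coupling), `VacuumSlackOn` (T), `SpectralDictOn` (D — literally the hypothesis list of
  `ThickSpeciesDatum.eblind_thick_pow`, p685489), `LabelNoiseOn` (N — dressing `J` anchored on the weight, (N-b)).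
* §C the four stub texts `EquiWindowV` (S3ʷ, FLOOR-FREE per R1), `VacuumSlackV` (T, graded LOCATED-HEAVY by crit-3), `SpectralDictV` (D, typing-provable,
  unproved), `LabelNoiseV` (N, LOCATED-HEAVY).
* §C′ `SplitVanishing`, `EquiUnits`, `EBlindUnitsV` — texts of record of skeleton rev 7 (b786d9ea556a), moved.

HONEST FRAMING.  Definitions only: nothing located is proved by this file (S1, S3ʷ, T, N, S5ᵛ open; D unproved); row 47 class PWP unchanged,
mechanism 0; the registered slot on 26930 (`Cruxes/IRcof/Lines/pinned_cofinal_bill.lean` rev 2) is untouched; `IRcof` ∕ `IR` 0∕1; the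
Yang–Mills mass gap (Clay) is NOT proved by anything in this tree; R4 closes only the conditional finite-𝕋⁴ rung `BalabanLadder.UV`.
-/
noncomputable section

open MeasureTheory Filter Topology
open Literature.MathematicalPhysics.QuantumFieldTheory Literature.MathematicalPhysics.QuantumLattice
open Summit.QuantumFields.YangMills.Cruxes.OSLegsFromFemtoAndGap.DlrCollarTransfer (LowerBounds)
open Summit.QuantumFields.YangMills.Theorems.NonSimplyConnectedLatticeGap

namespace Summit.QuantumFields.YangMills.Cruxes.IRcof.EquipartitionSeam.KernelCurrency

/-! ## §A Canonical objects of the `w`-theory (Summit conventions: time = axis 0, sectors = `Sector π`) -/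

section Objects

variable {G H : Type} [Group G] [TopologicalSpace G] [MeasurableSpace G] [Group H] [TopologicalSpace H]
  [IsTopologicalGroup H] [CompactSpace H] [MeasurableSpace H] [BorelSpace H]

/-- A sector `z : Plane → ker π` as a full twist tensor (upper triangle = the sector, `1` elsewhere), to be placed by the tree's
`tHooftTwistTensor` on the stacks `{x_μ = x_ν = 0}`. -/
def sectorTensor (π : H →* G) (z : Sector π) : Fin 4 → Fin 4 → H :=
  fun μ ν => if h : μ < ν then ((z ⟨(μ, ν), h⟩ : π.ker) : H) else 1

/-- Replace the ELECTRIC part of `z` (planes `(0, i+1)`, those containing the time axis `0`) by `e : Fin 3 → ker π`. -/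
def withEl (π : H →* G) (z : Sector π) (e : Fin 3 → ↥π.ker) : Sector π :=
  fun q => if q.1.1 = 0 then e ⟨(q.1.2 : ℕ) - 1, by have := q.1.2.isLt; omega⟩ else z q

/-- The electrically UNTWISTED member of `z`'s electric family (magnetic part kept). -/
def elOff (π : H →* G) (z : Sector π) : Sector π := withEl π z 1

/-- **`Z_w(z; s × (2S+1)³)`** — the tensor-twisted partition function of the `w`-THEORY (general central plaquette weight `w : H → ℝ`;
the split weight is not of Wilson form) on the `Fin`-box with TIME extent `s` along axis `0` and spatial cube `(2S+1)³`:
`∫ ∏_x ∏_{μ<ν} w(z_{x,μν} · U_{x,μν}) dHaar` — `wilsonFinTorusTensorTwistedPartition` with the Wilson weight replaced by `w`. -/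
def secZ (π : H →* G) (w : H → ℝ) (z : Sector π) (S s : ℕ) : ℝ :=
  ∫ U, ∏ x : FinTorusSite s (2 * S + 1) (2 * S + 1) (2 * S + 1), ∏ q : Plane,
      w (tHooftTwistTensor (sectorTensor π z) x q.1.1 q.1.2 * finTorusPlaquette U x q.1.1 q.1.2)
    ∂(Measure.pi fun _ : FinTorusSite s (2 * S + 1) (2 * S + 1) (2 * S + 1) × Fin 4 => haarProbability H)

/-- **`W_{w,A}(z)`** — the `z`-twisted `w`-theory integral of the pulled-back species `Ã(V) = A.F (π ∘ torusLift V)` on the SYMMETRIC box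
`(2S+1)⁴` (read through the tree's reindexing `finTorusConfigEquivSite`, which keeps the axis labels). -/
def secW (π : H →* G) (w : H → ℝ) (z : Sector π) (S : ℕ) (A : YMSpecies G) : ℝ :=
  ∫ U, A.F (fun e => π (torusLift (2 * S + 1) ((finTorusConfigEquivSite H (2 * S + 1)).symm U) e)) *
      ∏ x : FinTorusSite (2 * S + 1) (2 * S + 1) (2 * S + 1) (2 * S + 1), ∏ q : Plane,
        w (tHooftTwistTensor (sectorTensor π z) x q.1.1 q.1.2 * finTorusPlaquette U x q.1.1 q.1.2)
    ∂(Measure.pi fun _ : FinTorusSite (2 * S + 1) (2 * S + 1) (2 * S + 1) (2 * S + 1) × Fin 4 => haarProbability H)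

/-- **Principal growth rate `λ₊(w, z; S)`** `:= limsup_m Z_w(elOff z; (m+1) × (2S+1)³)^{1/(m+1)}` (the norm of the magnetically-`z`-twisted
slice transfer operator of the `w`-theory; mirrors `WilsonTransferKernel.transferSpectralRadius`). -/
def growthRate (π : H →* G) (w : H → ℝ) (z : Sector π) (S : ℕ) : ℝ :=
  limsup (fun m : ℕ => (secZ π w (elOff π z) S (m + 1)) ^ (((m : ℝ) + 1)⁻¹)) atTop

/-! ## §B Per-`β` predicates (S3ʷ, T, D, N at one coupling ∕ one split weight) -/

/-- **S3ʷ at one `w`: EQUIPARTITION ON THE NEAR-CUBIC WINDOW beyond `S_e`** — for `S ≥ S_e`, `3(2S+1) ≤ 4s ≤ 4(2S+1)` and electrically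
related `z, z'`: `|Z_w(z; s) − Z_w(z'; s)| ≤ e^{−(2S+2)} Z_w(z'; s)`. -/
def EquiWindowOn (π : H →* G) (w : H → ℝ) (S_e : ℕ) : Prop :=
  ∀ S : ℕ, S_e ≤ S → ∀ s : ℕ, 3 * (2 * S + 1) ≤ 4 * s → s ≤ 2 * S + 1 → ∀ z z' : Sector π,
    (∀ q : Plane, q.1.1 ≠ 0 → z q = z' q) →
      |secZ π w z S s - secZ π w z' S s| ≤ Real.exp (-(2 * (S : ℝ) + 2)) * secZ π w z' S s

/-- **T at one `w`: VACUUM THERMAL SLACK beyond `S_T` with constant `C_T`** — for `S ≥ S_T`, every sector `z` and `4ϱ ≤ 2S+1`: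
`λ₊(w,z;S)^ϱ · Z_w(elOff z; 2S+1−ϱ) ≤ C_T · Z_w(elOff z; 2S+1)` (`⟨e^{ϱE}⟩_{2S+1} ≤ C_T` in the magnetic sector of `z`). -/
def VacuumSlackOn (π : H →* G) (w : H → ℝ) (C_T : ℝ) (S_T : ℕ) : Prop :=
  ∀ S : ℕ, S_T ≤ S → ∀ z : Sector π, ∀ ϱ : ℕ, 4 * ϱ ≤ 2 * S + 1 →
    growthRate π w z S ^ ϱ * secZ π w (elOff π z) S (2 * S + 1 - ϱ) ≤ C_T * secZ π w (elOff π z) S (2 * S + 1)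

/-- **D at one `w`: the SPECTRAL DICTIONARY beyond `S_D`** — per electric family (base `z₀`) a joint eigen-datum of the `w`-theory's
magnetically-twisted slice transfer operator and the electric centre-twist operators, in the currency of `ThickSpeciesDatum.eblind_thick_pow`:
`0 ≤ λᵢ ≤ λ₊`, unit multiplicative `χᵢ` on `(Fin 3 → ker π)`, `Z_w(z₀|e; m) = Σᵢ χᵢ(e) λᵢ^m` (`m ≥ 2`), and for every species `A` with
`4·thick A ≤ 2S+1` diagonal coefficients `‖dᵢ‖ ≤ nrm A · λ₊^{thick A}` with `W_{w,A}(z₀|e) = Σᵢ χᵢ(e) λᵢ^{2S+1−thick A} dᵢ`. -/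
def SpectralDictOn (π : H →* G) (w : H → ℝ) (thick : YMSpecies G → ℕ) (nrm : YMSpecies G → ℝ) (S_D : ℕ) : Prop :=
  ∀ S : ℕ, S_D ≤ S → ∀ z₀ : Sector π, ∃ (ι : Type) (lam : ι → ℝ) (χ : ι → (Fin 3 → ↥π.ker) → ℂ),
    (∀ i, 0 ≤ lam i ∧ lam i ≤ growthRate π w z₀ S) ∧ (∀ i a b, χ i (a * b) = χ i a * χ i b) ∧ (∀ i a, ‖χ i a‖ = 1) ∧
    (∀ m : ℕ, 2 ≤ m → ∀ e : Fin 3 → ↥π.ker,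
        HasSum (fun i => χ i e * ((lam i ^ m : ℝ) : ℂ)) ((secZ π w (withEl π z₀ e) S m : ℝ) : ℂ)) ∧
    (∀ A : YMSpecies G, 4 * thick A ≤ 2 * S + 1 → ∃ d : ι → ℂ,
        0 ≤ nrm A ∧ (∀ i, ‖d i‖ ≤ nrm A * growthRate π w z₀ S ^ thick A) ∧
        ∀ e : Fin 3 → ↥π.ker,
          HasSum (fun i => χ i e * ((lam i ^ (2 * S + 1 - thick A) : ℝ) : ℂ) * d i) ((secW π w (withEl π z₀ e) S A : ℝ) : ℂ))

/-- **N at one `(β, w)`: LABEL NOISE beyond `S_N`** — per torus `S ≥ S_N` and per MAGNETIC family (base `z₀`; members `z₀|e`,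
`e : Fin 3 → ker π`) ONE normalisation `Nrm > 0` (it absorbs the coboundary count AND the family's defect-gas factor) with
(weights) `p_{z₀|e} = Nrm · Z_w(z₀|e; 2S+1) · (1 ± e^{−(2S+1)}/8)` for every `e`, and (species) for every species `A` bounded by `C_A` ONE
dressing constant `J` ANCHORED ON THE WEIGHT `p_{z₀|e}` (pool-p3 (N-b) l.1612: the defect-gas dressing of `A`, independent of `e`; it then cancels IDENTICALLY in the EBLIND cross-difference) with
`|∫_{E_{z₀|e}} Ã − Nrm · (W_{w,A}(z₀|e) + J · Z_w(z₀|e; 2S+1))| ≤ (e^{−(2S+1)}/8) · C_A · Nrm · Z_w(z₀|e; 2S+1)` for every `e`.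
(`J` cancels in the EBLIND cross-difference; `Nrm` cancels in every ratio the bridges form.) -/
def LabelNoiseOn (π : H →* G) (r : LatticeRep G) (β : ℝ) (cls : Labelling π) (w : H → ℝ) (S_N : ℕ) : Prop :=
  ∀ S : ℕ, S_N ≤ S → ∀ z₀ : Sector π, ∃ Nrm : ℝ, 0 < Nrm ∧
    (∀ e : Fin 3 → ↥π.ker,
      |((wilsonMeasure (r.ρ.comp π) β : Measure (GaugeConfig 4 (2 * S + 1) H)) ((cls S) ⁻¹' {some (withEl π z₀ e)})).toReal -
          Nrm * secZ π w (withEl π z₀ e) S (2 * S + 1)| ≤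
        Real.exp (-(2 * (S : ℝ) + 1)) / 8 * (Nrm * secZ π w (withEl π z₀ e) S (2 * S + 1))) ∧
    ∀ (A : YMSpecies G) (C_A : ℝ), (∀ U, |A.F U| ≤ C_A) → ∃ J : ℝ, ∀ e : Fin 3 → ↥π.ker,
      |(∫ V in ((cls S) ⁻¹' {some (withEl π z₀ e)}), A.F (fun e' => π (torusLift (2 * S + 1) V e'))
          ∂(wilsonMeasure (r.ρ.comp π) β : Measure (GaugeConfig 4 (2 * S + 1) H))) -
          (Nrm * secW π w (withEl π z₀ e) S A + J *
            ((wilsonMeasure (r.ρ.comp π) β : Measure (GaugeConfig 4 (2 * S + 1) H))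
              ((cls S) ⁻¹' {some (withEl π z₀ e)})).toReal)| ≤
        Real.exp (-(2 * (S : ℝ) + 1)) / 8 * C_A * (Nrm * secZ π w (withEl π z₀ e) S (2 * S + 1))

end Objects

/-! ## §C The four stub texts (rev 8 (β)): S3ʷ, T, D, N -/

/-- **S3ʷ `EquiWindowV`** — EQUI ON THE WINDOW for every admissible split weight.  Telescope = S3's MINUS the unit map ∕ floors
(`au`, `LowerBounds G r au` — FLOOR-FREE, pool-p3 R1 l.1610: the conclusion never mentions `au`, and S4ᵛ, which B2 must conclude, is floor-free)
+ the split-noise rate `c(β)β → ∞`.  Why it might fail: as S3 — a 't Hooft-deconfined window of the `w`-theory at arbitrarily large `β` on 3:4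
boxes.  Sources: 't Hooft 1979 §5; Tomboulis–Yaffe 1985; Borgs–Seiler 1983 §II. -/
def EquiWindowV : Prop :=
  ∀ (G : Type) [Group G] [TopologicalSpace G] [IsTopologicalGroup G] [CompactSpace G] [MeasurableSpace G]
    [BorelSpace G], IsCompactSimpleLieGroup G → ∀ (H : Type) [Group H] [TopologicalSpace H] [IsTopologicalGroup H]
    [CompactSpace H] [MeasurableSpace H] [BorelSpace H], IsCompactSimpleLieGroup H → SimplyConnectedSpace H →
    ∀ (π : H →* G), Continuous π → Function.Surjective π → π.ker ≤ Subgroup.center H → (π.ker : Set H).Finite →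
    π.ker ≠ ⊥ → ∀ (ρH : LatticeRep H) (r : LatticeRep G) (c : ℝ → ℝ), Tendsto (fun β => c β * β) atTop atTop →
      ∃ (β_e : ℝ) (S_e : ℝ → ℕ), ∀ β : ℝ, β_e ≤ β → ∀ w : H → ℝ, TwistSplitWeight π ρH r (c β) β w →
        EquiWindowOn π w (S_e β)

/-- **T `VacuumSlackV`** — VACUUM SLACK for every admissible split weight, ONE constant `C_T > 0` uniform in `β ≥ β_T`, thresholds `S_T(β)`.
Why it might fail: a finite-volume Hagedorn-type proliferation of states at scale `1/(2S+1)` along the cofinal window; and its β-UNIFORM proof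
is UV-flavoured (finite-size free energy at scale `1/t`, Bałaban-type input) — LOCATED-HEAVY.  Sources: 't Hooft 1979; Lüscher 1983 (femto
universe); Bałaban 1983–89 (UV stability). -/
def VacuumSlackV : Prop :=
  ∀ (G : Type) [Group G] [TopologicalSpace G] [IsTopologicalGroup G] [CompactSpace G] [MeasurableSpace G]
    [BorelSpace G], IsCompactSimpleLieGroup G → ∀ (H : Type) [Group H] [TopologicalSpace H] [IsTopologicalGroup H]
    [CompactSpace H] [MeasurableSpace H] [BorelSpace H], IsCompactSimpleLieGroup H → SimplyConnectedSpace H →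
    ∀ (π : H →* G), Continuous π → Function.Surjective π → π.ker ≤ Subgroup.center H → (π.ker : Set H).Finite →
    π.ker ≠ ⊥ → ∀ (ρH : LatticeRep H) (r : LatticeRep G) (c : ℝ → ℝ), Tendsto (fun β => c β * β) atTop atTop →
      ∃ (C_T β_T : ℝ) (S_T : ℝ → ℕ), 0 < C_T ∧ ∀ β : ℝ, β_T ≤ β → ∀ w : H → ℝ, TwistSplitWeight π ρH r (c β) β w →
        VacuumSlackOn π w C_T (S_T β)

/-- **D `SpectralDictV`** — the SPECTRAL DICTIONARY for every admissible split weight, with species thickness `thick` and size `nrm` chosen ONCE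
(independent of `β`, `S`, `w`).  Typing-provable in principle (slice kernel of the `w`-theory along axis 0 with magnetic twist and Gauss projection:
`w` of positive type ⇒ `𝕋 ⪰ 0`; trace formula `Z = tr U(e)𝕋^m`, cyclicity for the insertion, `PathKernelDomination` for `‖𝔹_A‖ ≤ ‖A‖∞ λ₊^ϱ`;
templates `TwistedKernelTraceFormula`, `TwistedKernelFluxSectors`, `WilsonFinTorus{SliceKernel,MagneticSliceKernel,TwistedPartitionSwap}`),
M∕L-sized; why it might fail AS TYPED: a convention slip (twist orientation ∕ conjugate characters) — repairable by re-indexing. -/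
def SpectralDictV : Prop :=
  ∀ (G : Type) [Group G] [TopologicalSpace G] [IsTopologicalGroup G] [CompactSpace G] [MeasurableSpace G]
    [BorelSpace G], IsCompactSimpleLieGroup G → ∀ (H : Type) [Group H] [TopologicalSpace H] [IsTopologicalGroup H]
    [CompactSpace H] [MeasurableSpace H] [BorelSpace H], IsCompactSimpleLieGroup H → SimplyConnectedSpace H →
    ∀ (π : H →* G), Continuous π → Function.Surjective π → π.ker ≤ Subgroup.center H → (π.ker : Set H).Finite →
    π.ker ≠ ⊥ → ∀ (ρH : LatticeRep H) (r : LatticeRep G) (c : ℝ → ℝ), Tendsto (fun β => c β * β) atTop atTop →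
      ∃ (thick : YMSpecies G → ℕ) (nrm : YMSpecies G → ℝ) (β_D : ℝ) (S_D : ℝ → ℕ), ∀ β : ℝ, β_D ≤ β →
        ∀ w : H → ℝ, TwistSplitWeight π ρH r (c β) β w → SpectralDictOn π w thick nrm (S_D β)

/-- **N `LabelNoiseV`** — LABEL NOISE for every interface labelling family and every admissible split weight, beyond thresholds `S_N(β)`,
`β ≥ β_N`.  LOCATED (the transfer dictionary's physical half): why it might fail — interface labels are not literally the twist sectors of the
exact Mack–Petkova expansion `Z_blind = N₁ Σ_z Z_w^{tw}(z)` (defect networks near the cut; the interface's `e^{−(2S+1)}` noise is in measure,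
and a RELATIVE error against a suppressed sector `Z_w^{tw}(z)` needs `S ≳ ξ(β)`, whence the thresholds).  Sources: Mack–Petkova 1979;
Tomboulis 2007 (arXiv:0707.2179) §2–3; 't Hooft 1979. -/
def LabelNoiseV : Prop :=
  ∀ (G : Type) [Group G] [TopologicalSpace G] [IsTopologicalGroup G] [CompactSpace G] [MeasurableSpace G]
    [BorelSpace G], IsCompactSimpleLieGroup G → ∀ (H : Type) [Group H] [TopologicalSpace H] [IsTopologicalGroup H]
    [CompactSpace H] [MeasurableSpace H] [BorelSpace H], IsCompactSimpleLieGroup H → SimplyConnectedSpace H →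
    ∀ (π : H →* G), Continuous π → Function.Surjective π → π.ker ≤ Subgroup.center H → (π.ker : Set H).Finite →
    π.ker ≠ ⊥ → ∀ (ρH : LatticeRep H) (r : LatticeRep G) (a : ℝ) (cls : Labelling π),
    (∀ S : ℕ, TwistSectorInterface π ρH r a S (cls S)) → ∀ c : ℝ → ℝ, Tendsto (fun β => c β * β) atTop atTop →
      ∃ (β_N : ℝ) (S_N : ℝ → ℕ), ∀ β : ℝ, β_N ≤ β → ∀ w : H → ℝ, TwistSplitWeight π ρH r (c β) β w →
        LabelNoiseOn π r β cls w (S_N β)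


end Summit.QuantumFields.YangMills.Cruxes.IRcof.EquipartitionSeam.KernelCurrency

/-! ## §C′ Texts of record of skeleton rev 7 (`SplitVanishing` l.171, `EquiUnits` = S3 l.183, `EBlindUnitsV` = S4ᵛ l.198), moved to the PARENT
namespace so that rev 8 and the bridges cite them BY NAME -/

namespace Summit.QuantumFields.YangMills.Cruxes.IRcof.EquipartitionSeam

/-- **S2ᵛ `SplitVanishing`** — text of record of skeleton rev 7 l.171 (a THEOREM there: `splitVanishing_holds := SchurFejer.splitVanishing_text`): at every cover datum a splitting weight with label noise `e^{−c(β)β} → 0` exists for all large `β`. -/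
def SplitVanishing : Prop :=
  ∀ (G : Type) [Group G] [TopologicalSpace G] [IsTopologicalGroup G] [CompactSpace G] [MeasurableSpace G]
    [BorelSpace G], IsCompactSimpleLieGroup G → ∀ (H : Type) [Group H] [TopologicalSpace H] [IsTopologicalGroup H]
    [CompactSpace H] [MeasurableSpace H] [BorelSpace H], IsCompactSimpleLieGroup H → SimplyConnectedSpace H →
    ∀ (π : H →* G), Continuous π → Function.Surjective π → π.ker ≤ Subgroup.center H → (π.ker : Set H).Finite →
    π.ker ≠ ⊥ → ∀ (ρH : LatticeRep H) (r : LatticeRep G),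
      ∃ c : ℝ → ℝ, Tendsto (fun β => c β * β) atTop atTop ∧ ∃ β_s : ℝ, ∀ β : ℝ, β_s ≤ β →
        ∃ w : H → ℝ, TwistSplitWeight π ρH r (c β) β w

/-- **S3 `EquiUnits`** — text of record of skeleton rev 7 l.183 (EQUI in units; wall-2-lite): under the floors, unit equipartition beyond thresholds `S_e(β)` for all large `β`. -/
def EquiUnits : Prop :=
  ∀ (G : Type) [Group G] [TopologicalSpace G] [IsTopologicalGroup G] [CompactSpace G] [MeasurableSpace G]
    [BorelSpace G], IsCompactSimpleLieGroup G → ∀ (H : Type) [Group H] [TopologicalSpace H] [IsTopologicalGroup H]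
    [CompactSpace H] [MeasurableSpace H] [BorelSpace H], IsCompactSimpleLieGroup H → SimplyConnectedSpace H →
    ∀ (π : H →* G), Continuous π → Function.Surjective π → π.ker ≤ Subgroup.center H → (π.ker : Set H).Finite →
    π.ker ≠ ⊥ → ∀ (ρH : LatticeRep H) (r : LatticeRep G) (au : ℝ → ℝ), (∀ β, 0 < au β) →
    Tendsto au atTop (𝓝 0) → LowerBounds G r au → ∀ (a : ℝ) (cls : Labelling π),
    (∀ S : ℕ, TwistSectorInterface π ρH r a S (cls S)) →
      ∃ (β_e : ℝ) (S_e : ℝ → ℕ), ∀ β : ℝ, β_e ≤ β → EquiUnitOn π r β cls (S_e β)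

/-- **S4ᵛ `EBlindUnitsV`** — text of record of skeleton rev 7 l.198 (EBLIND in units, the seam; vanishing-noise split): species-uniform thresholds and per-species constants uniform in `β`. -/
def EBlindUnitsV : Prop :=
  ∀ (G : Type) [Group G] [TopologicalSpace G] [IsTopologicalGroup G] [CompactSpace G] [MeasurableSpace G]
    [BorelSpace G], IsCompactSimpleLieGroup G → ∀ (H : Type) [Group H] [TopologicalSpace H] [IsTopologicalGroup H]
    [CompactSpace H] [MeasurableSpace H] [BorelSpace H], IsCompactSimpleLieGroup H → SimplyConnectedSpace H →
    ∀ (π : H →* G), Continuous π → Function.Surjective π → π.ker ≤ Subgroup.center H → (π.ker : Set H).Finite →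
    π.ker ≠ ⊥ → ∀ (ρH : LatticeRep H) (r : LatticeRep G) (a : ℝ) (cls : Labelling π),
    (∀ S : ℕ, TwistSectorInterface π ρH r a S (cls S)) → ∀ c : ℝ → ℝ, Tendsto (fun β => c β * β) atTop atTop →
    ∀ β_s : ℝ, (∀ β : ℝ, β_s ≤ β → ∃ w : H → ℝ, TwistSplitWeight π ρH r (c β) β w) → ∀ (β_e : ℝ) (S_e : ℝ → ℕ),
    (∀ β : ℝ, β_e ≤ β → EquiUnitOn π r β cls (S_e β)) →
      ∃ (β_b : ℝ) (S_b : ℝ → ℕ), ∀ A : YMSpecies G, ∃ C : ℝ, ∀ β : ℝ, β_b ≤ β → EBlindUnitOn π r β cls (S_b β) A C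

end Summit.QuantumFields.YangMills.Cruxes.IRcof.EquipartitionSeam

/-! ## §A″ (append, LEAD g8 on idea-22 g6's LAND-ASK l.1628) — the electric-part selector `elPart` of the staging copy
`Cruxes/IRcof/Lines/equipartition_seam_KernelDefs.lean` 511fab2419eb §A, VERBATIM, in the same namespace and variable context -/

namespace Summit.QuantumFields.YangMills.Cruxes.IRcof.EquipartitionSeam.KernelCurrency

section ObjectsAppend

variable {G H : Type} [Group G] [TopologicalSpace G] [MeasurableSpace G] [Group H] [TopologicalSpace H]
  [IsTopologicalGroup H] [CompactSpace H] [MeasurableSpace H] [BorelSpace H]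

/-- The electric part of a sector (planes `(0, i+1)`); `withEl π z₀ (elPart π z) = z` for electrically related `z₀`, `z`. -/
def elPart (π : H →* G) (z : Sector π) : Fin 3 → ↥π.ker := fun i => z ⟨(0, i.succ), Fin.succ_pos i⟩

end ObjectsAppend

end Summit.QuantumFields.YangMills.Cruxes.IRcof.EquipartitionSeam.KernelCurrency

end
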